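import Literature.MathematicalPhysics.QuantumFieldTheory.Balaban1983to89.B9Eq316PenaltyLocalLetter
import Literature.MathematicalPhysics.QuantumFieldTheory.Balaban1983to89.B9Eq315QFlatNorm

/-!
# `Balaban1983to89.B9Eq315QSingleBondLetter` — T. Bałaban, *Propagators for lattice gauge theories in a background field*, Commun. Math. Phys. **99**
# (1985) 389–434 [Balaban1985BackgroundPropagators] (3.15)–(3.16) p. 393 (the vector-field averaging `Q(U)` and the penalty `Q*aQ`), (3.26) p. 395, with
# [Balaban1985Averaging] (124)–(126) p. 36 *«(Q₀A)_c = Σ_{x∈B(c₋)} L^{−(d+1)}(R_{0,c₋}A)([x, x′]) … |(Q₀A)_c| ≤ |A|»*, p. 24 *«depends only on the bond variables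
# … b ⊂ B(c₋) ∪ B(c₊)»*: **THE SHARP SINGLE-BOND LETTER OF THE ONE-STEP AVERAGING — `‖(Q(U)δ_b^u)(c)‖ ≤ M_φ′·(L^{−d} + 50(d+1)α)·M_φ·‖u‖`, its column
# form `Σ_c ‖(Q(U)δ_b^u)(c)‖ ≤ M_φ′·(L^{−d} + 100d(d+1)α)·M_φ·‖u‖`, the `ℓ¹ → ℓ¹` letter `Σ_c ‖(Q(U)A)(c)‖ ≤ (L^{−d} + 100d(d+1)α)·Σ_b ‖A(b)‖`, and the
# penalty's local sup letter with print's size `O(|a|)` on the one-step diagonal `c₁ = L^d c₀`** — the letter t4-ne9-idea-1 located (remark L-g150-7, journal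
# l.62730: «display `k` as a LETTER `k_Q` (inhabited crudely now, sharply later by a single-bond letter `‖(Qδ_b^u)(c)‖ ≤ M_φ′M_φ·C·L^{−d}‖u‖` if someone types
# it)»): `δ_b^u` is ONE summand of the normalised average (125), so the MAIN term sees it with weight `L^{−(d+1)}·#{straight paths through b} ≤ L^{−d}`, and
# only the `[operator − 1] = O(α)` defect brackets of (124) (`B7Prop3GeneralLinearBound.norm_linQcov_sub_main_le`) are paid at the crude sup rate

statement-level skeleton of published theorems with citation tags; proofs where landed; nothing here is a claim about the Yang–Mills mass gap

CITATION HEADER (lean-in-tree rule).  Audit cell `pub-balaban`, sub-cell `t4`, BINDER row NE9; filed by NE9 crux-team LEAF PROVER 03 (`b2b-balaban-t4-ne9-formalise-leaf-03`,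
gen 78; road ΔA-CT, OFFER O-leaf03-g78-1 toward beta-an4's INTERFACE REQUEST D4).  Imports ne9-leaf-05's `B9Eq316PenaltyLocalLetter` (`alpha_nonneg`, the `k_Q`-DISPLAYED
consumers `norm_adjoint∕penalty_QtorusW_apply_le_local_of_letter`; through it `B9Eq315QLocalLetter.QtorusLin_apply_eq_zero_of_support`, `B9Eq383QSemiLocal.card_near_le`,
the NE7c crew's `B7Prop3GeneralLinearBound.norm_linQcov_sub_main_le` = [B7] (124)–(126) with explicit `O(1)`) and the OWNER's `B9Eq315QFlatNorm` (`sum_chart_le`).  Sources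
READ first-hand in the held text layers (`paper:balaban1985-cmp98-averaging` p. 36 (124)–(126) «the main term … |(Q₀A)_c| ≤ |A|», p. 24 «this definition is local»;
`paper:balaban1985-cmp99-background-propagators` p. 393 (3.15)–(3.16) «compositions of one-step averaging operators … Q(V) is given by the explicit formula (124) in
[5]»).  NOTHING of print's proofs beyond the cited identities is used; [folklore] counting + the tree's (126) remainder BY NAME.

WHAT IS PROVED (sorry-free; proof lane — 0 `def`; [folklore]).
* §1 (`ℤ^d`, `U1` background) `norm_tsum_replicate_le_sum` (a straight path sum is bounded by the SUM of the norms it visits), **`norm_Q0cov_le_sum`**.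
* §2 (torus) **`norm_QtorusLin_apply_le_sum_add`** — `‖(Q(U)A)(c)‖ ≤ L^{−(d+1)}·Σ_r Σ_{i<L} ‖A((L·c₋ + r + ie_{c.2}) mod Lm, c.2)‖ + 50(d+1)α·sup‖A‖`.
* §3 spikes `δ_b^X`: `sum_main_single_le` (the main sums of ALL coarse bonds together see `b` at most `L` times), `main_single_le`,
  **`norm_QtorusLin_single_le`** (`‖(Q(U)δ_b^X)(c)‖ ≤ (L^{−d} + 50(d+1)α)‖X‖`), **`sum_norm_QtorusLin_single_le`** (`Σ_c … ≤ (L^{−d} + 2d·50(d+1)α)‖X‖`).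
* §4 **`sum_norm_QtorusLin_le`** — THE `ℓ¹ → ℓ¹` LETTER `Σ_c ‖(Q(U)A)(c)‖ ≤ (L^{−d} + 100d(d+1)α)·Σ_b ‖A(b)‖`; the one-step factor of the tower's composite
  letter (product of the level constants `L^{−d}(1 + 100d(d+1)L^dα_j)`, height-free under a summable loop window — next file).
* §5 (the chain's carriers) **`norm_QtorusW_single_le`** — the SHARP `k_Q = M_φ′(L^{−d} + 50(d+1)α)M_φ`; **`norm_adjoint_QtorusW_apply_le_local_sharp`**,
  **`norm_penalty_QtorusW_apply_le_local_sharp`** (ne9-leaf-05's `…_of_letter` consumers at the sharp `k_Q`), **`…_sharp_diagonal`** (`c₁ = L^d·c₀`: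
  `‖((Q†(a•Q))v)(b)‖ ≤ |a|·(1 + 50(d+1)αL^d)·M_φ′M_φ·2d·(M_φ′C_QM_φ)·M` — print's `O(|a|)` size of `Q*aQ`, no `L^d` in front).
HONEST SCOPE.  Counting + composition; the defect brackets are paid at the crude rate `50(d+1)α` (not `α∕L`); one step only (the tower composite is the next
file); nothing of [B9] Thm 3.1∕3.3 asserted; «NE9 ⇐ the named binders»; NE9 NOT PRINTED ∕ NOT PROVED; row WALLED ON A MODEL (O-NE9-1; #5 UNRULED); spine PROVED
0∕9; rung (B)+1 on a finite T⁴ — NOT infinite volume, NOT mass gap, NOT BetaPertH, NOT Clay.  HONEST DEPENDENCY: continuum YM on T⁴ ⇐ BetaPertH ∧ nine spine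
estimates (0/9 proved); BetaPertH ⇐ (D1) ∧ (D4) ∧ CAP+tail; G-an2-4 gates asym, D1 and NE2/3/4.  NEW file; nothing modified.  Net new unproved facts: 0.
-/

noncomputable section

open scoped BigOperators

namespace Literature.MathematicalPhysics.QuantumFieldTheory.Balaban1983to89.B9Eq315QSingleBondLetter

open B4Sect5Torus (TSite tdist)
open B9SectCLatticeCarrier (Bond shift)
open B9Eq311L2Pairing (WL2)
open B11Eq103H1Complex (BondL2K)
open B9Eq319QprimeTorus (fineP blockCoord)
open B7Prop1Explicit (Letter e U1 hol hol_mem stepHol_mem boxVec Wcx seg seg_natCast treeWord)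
open B7Eq78Linearization (conjR)
open B7Prop3GeneralRotated (tsum tsum_nil tsum_cons tstep norm_conjR_le)
open B7Prop3GeneralLinear (Q0cov linQcov)
open B7Prop3GeneralLinearBound (norm_linQcov_sub_main_le)
open B9Eq315QTorus (perSite perCfg perCfg_apply cornerSite QtorusLin QtorusLin_apply QtorusW QtorusW_apply)
open B9Eq315QFlatNorm (sum_chart_le)
open B9Eq383QSemiLocal (card_near_le)
open B9Eq315QLocalLetter (QtorusLin_apply_eq_zero_of_support)
open B9Eq316PenaltyLocalLetter (alpha_nonneg norm_adjoint_QtorusW_apply_le_local_of_letter norm_penalty_QtorusW_apply_le_local_of_letter)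

/-! ## §1 On `ℤ^d`: a straight path sum is bounded by the sum of the norms it visits -/

section Lattice

variable {d : ℕ} {𝔸 : Type*} [NormedRing 𝔸] [NormedAlgebra ℂ 𝔸] [CompleteSpace 𝔸] [NormOneClass 𝔸] (L : ℕ)
  {V₀ : B7Prop1Explicit.Site d → Fin d → 𝔸ˣ} (hV₀ : ∀ x κ, V₀ x κ ∈ U1 𝔸)

omit [NormedAlgebra ℂ 𝔸] [CompleteSpace 𝔸] in
include hV₀ in
/-- **A STRAIGHT-SEGMENT PATH SUM IS BOUNDED BY THE SUM OF THE NORMS IT VISITS**: `‖(R_{0,x}A)([x, x + ne_κ])‖ ≤ Σ_{i<n} ‖A(x + ie_κ, κ)‖` (the rotations by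
the `U1` transports do not increase norms). [folklore] [cite: Balaban1985Averaging, (125)–(126) p.36, (58) p.27] -/
theorem norm_tsum_replicate_le_sum (A : B7Prop1Explicit.Site d → Fin d → 𝔸) (κ : Fin d) :
    ∀ (n : ℕ) (x : B7Prop1Explicit.Site d), ‖tsum V₀ A x (List.replicate n (κ, true))‖ ≤ ∑ i ∈ Finset.range n, ‖A (x + (i : ℤ) • e κ) κ‖
  | 0, x => by simp
  | n + 1, x => by
    rw [List.replicate_succ, tsum_cons, Finset.sum_range_succ']
    have hstep : tstep V₀ A x (κ, true) = A x κ := by simp [tstep]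
    have hvec : Letter.vec (κ, true) = e κ := by simp [Letter.vec]
    rw [hstep, hvec]
    refine (norm_add_le _ _).trans ?_
    rw [add_comm]
    refine add_le_add ?_ (by simp)
    refine (norm_conjR_le (stepHol_mem hV₀ x _) _).trans ((norm_tsum_replicate_le_sum A κ n (x + e κ)).trans (le_of_eq ?_))
    refine Finset.sum_congr rfl fun i _ => ?_
    congr 2
    push_cast
    rw [add_smul, one_smul, add_assoc, add_comm (e κ)]

omit [CompleteSpace 𝔸] in
include hV₀ in
/-- **THE MAIN TERM (125) AGAINST THE SUM OF NORMS**: `‖Q0cov‖ ≤ L^{−(d+1)}·Σ_r Σ_{i<L} ‖A(q + r + ie_κ, κ)‖` (the rotation `R(V₀(Γ_{c₋,x}))` by the tree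
contour is norm-non-increasing; the segment by `norm_tsum_replicate_le_sum`). [cite: Balaban1985Averaging, (125)–(126) p.36] -/
theorem norm_Q0cov_le_sum (A : B7Prop1Explicit.Site d → Fin d → 𝔸) (q : B7Prop1Explicit.Site d) (κ : Fin d) :
    ‖Q0cov L V₀ A q κ‖ ≤ ((L : ℝ) ^ (d + 1))⁻¹ * ∑ r : Fin d → Fin L, ∑ i ∈ Finset.range L, ‖A (q + boxVec L r + (i : ℤ) • e κ) κ‖ := by
  unfold Q0cov
  rw [Finset.mul_sum]
  refine norm_sum_le_of_le _ fun r _ => ?_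
  rw [norm_smul, Real.norm_of_nonneg (by positivity)]
  refine mul_le_mul_of_nonneg_left ?_ (by positivity)
  refine (norm_conjR_le (hol_mem hV₀ _ _) _).trans ?_
  have h := norm_tsum_replicate_le_sum hV₀ A κ L (q + boxVec L r)
  rwa [← seg_natCast] at h

end Lattice

/-! ## §2 On the torus: `‖(Q(U)A)(c)‖ ≤` main sum `+ 50(d+1)α·sup‖A‖` -/

section Torus

variable {d : ℕ} (L : ℕ) [NeZero L] (m : Fin d → ℕ) [∀ i, NeZero (m i)] [∀ i, NeZero (fineP L m i)]
  {𝔸 : Type*} [NormedRing 𝔸] [NormedAlgebra ℂ 𝔸] [CompleteSpace 𝔸] [NormOneClass 𝔸] (hL : 1 ≤ L)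
  (U : Bond d (fineP L m) → 𝔸ˣ) {α : ℝ} (hα1 : α ≤ 1 / 64)
  (hU1 : ∀ (x : B7Prop1Explicit.Site d) (κ : Fin d), perCfg (fineP L m) U x κ ∈ U1 𝔸)
  (hreg : ∀ (y : TSite d m) (κ : Fin d) (r : Fin d → Fin L),
    ‖((Wcx L (perCfg (fineP L m) U) (cornerSite L y) κ (boxVec L r) : 𝔸ˣ) : 𝔸) - 1‖ ≤ α)

include hL in
omit [NeZero L] [∀ i, NeZero (m i)] in
/-- **`‖(Q(U)A)(c)‖ ≤ L^{−(d+1)}·Σ_r Σ_{i<L} ‖A((L·c₋ + r + ie_{c.2}) mod Lm, c.2)‖ + 50(d+1)α·a`** whenever `‖A(b)‖ ≤ a` everywhere: (124) = main term (125) +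
the `[operator − 1]` brackets (`norm_linQcov_sub_main_le`, loop smallness `α ≤ 1∕64 ≤ 1∕8`), the main term by `norm_Q0cov_le_sum`, all divided by `L`.
[cite: Balaban1985Averaging, (124)–(126) p.36; Balaban1985BackgroundPropagators, (3.15) p.393] -/
theorem norm_QtorusLin_apply_le_sum_add (A : Bond d (fineP L m) → 𝔸) {a : ℝ} (ha : 0 ≤ a) (hA : ∀ b, ‖A b‖ ≤ a) (c : Bond d m) :
    ‖QtorusLin L m hL U hα1 hU1 hreg A c‖ ≤
      ((L : ℝ) ^ (d + 1))⁻¹ * ∑ r : Fin d → Fin L, ∑ i ∈ Finset.range L,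
          ‖A (perSite (fineP L m) (cornerSite L c.1 + boxVec L r + (i : ℤ) • e c.2), c.2)‖ + 50 * (d + 1) * α * a := by
  have hLpos : (0 : ℝ) < L := by exact_mod_cast hL
  have hα0 : 0 ≤ α := alpha_nonneg L m hL U hreg c
  have hα8 : α ≤ 1 / 8 := hα1.trans (by norm_num)
  have hAp : ∀ (x : B7Prop1Explicit.Site d) (κ : Fin d), ‖perCfg (fineP L m) A x κ‖ ≤ a := fun x κ => hA _
  have hrem := norm_linQcov_sub_main_le L hU1 ha hAp hL (cornerSite L c.1) c.2 hα0 hα8 (hreg c.1 c.2)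
  have hmain := norm_Q0cov_le_sum L hU1 (perCfg (fineP L m) A) (cornerSite L c.1) c.2
  simp only [perCfg_apply] at hmain
  rw [QtorusLin_apply, norm_smul, norm_inv, Complex.norm_natCast, inv_mul_le_iff₀ hLpos]
  have hsplit : linQcov L (perCfg (fineP L m) U) (perCfg (fineP L m) A) (cornerSite L c.1) c.2 =
      (linQcov L (perCfg (fineP L m) U) (perCfg (fineP L m) A) (cornerSite L c.1) c.2 -
          (L : ℝ) • Q0cov L (perCfg (fineP L m) U) (perCfg (fineP L m) A) (cornerSite L c.1) c.2) +
        (L : ℝ) • Q0cov L (perCfg (fineP L m) U) (perCfg (fineP L m) A) (cornerSite L c.1) c.2 := by abel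
  rw [hsplit]
  refine (norm_add_le _ _).trans ?_
  rw [norm_smul, Real.norm_of_nonneg hLpos.le, mul_add, mul_comm (L : ℝ) (((L : ℝ) ^ (d + 1))⁻¹ * _)]
  have h2 : (L : ℝ) * ‖Q0cov L (perCfg (fineP L m) U) (perCfg (fineP L m) A) (cornerSite L c.1) c.2‖ ≤
      ((L : ℝ) ^ (d + 1))⁻¹ * (∑ r : Fin d → Fin L, ∑ i ∈ Finset.range L,
          ‖A (perSite (fineP L m) (cornerSite L c.1 + boxVec L r + (i : ℤ) • e c.2), c.2)‖) * L := by
    rw [mul_comm]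
    exact mul_le_mul_of_nonneg_right hmain hLpos.le
  nlinarith [hrem, h2]

/-! ## §3 Spikes: the main sums see a single bond at most `L` times -/

omit [NeZero L] [∀ i, NeZero (m i)] [∀ i, NeZero (fineP L m i)] [NormedAlgebra ℂ 𝔸] [CompleteSpace 𝔸] [NormOneClass 𝔸] in
/-- The spike's values: `‖δ_b^X(x, κ)‖ = ‖X‖` at `(x, κ) = b` and `0` elsewhere, written with the indicator of `b₋` and of the direction. [folklore]
[cite: Balaban1985BackgroundPropagators, (3.15) p.393] -/
theorem norm_single_apply_eq [DecidableEq (Bond d (fineP L m))] (b : Bond d (fineP L m)) (X : 𝔸) (x : TSite d (fineP L m)) (κ : Fin d) :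
    ‖(Pi.single b X : Bond d (fineP L m) → 𝔸) (x, κ)‖ = if κ = b.2 then (if x = b.1 then ‖X‖ else 0) else 0 := by
  obtain ⟨b1, b2⟩ := b
  rw [Pi.single_apply]
  split_ifs with h h1 h2 h3 <;> simp_all [Prod.ext_iff]

omit [∀ i, NeZero (m i)] [NormedAlgebra ℂ 𝔸] [CompleteSpace 𝔸] [NormOneClass 𝔸] in
/-- **THE MAIN SUMS OF ALL COARSE BONDS TOGETHER SEE THE BOND `b` AT MOST `L` TIMES**: for the spike `δ_b^X`,
`Σ_c Σ_r Σ_{i<L} ‖δ_b^X((L·c₋ + r + ie_{c.2}) mod Lm, c.2)‖ ≤ L·‖X‖` — only the direction `c.2 = b.2` contributes, and for each `i < L` the shifted block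
chart `(y, r) ↦ (L·y + r + ie_κ) mod Lm` is injective (`sum_chart_le`), so it hits `b₋` at most once. [folklore]
[cite: Balaban1985Averaging, (125) p.36, (1)–(2) p.17; Balaban1985BackgroundPropagators, (3.15) p.393] -/
theorem sum_main_single_le [DecidableEq (Bond d (fineP L m))] (b : Bond d (fineP L m)) (X : 𝔸) :
    ∑ c : Bond d m, ∑ r : Fin d → Fin L, ∑ i ∈ Finset.range L,
        ‖(Pi.single b X : Bond d (fineP L m) → 𝔸) (perSite (fineP L m) (cornerSite L c.1 + boxVec L r + (i : ℤ) • e c.2), c.2)‖ ≤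
      L * ‖X‖ := by
  -- the indicator of `b₋` on the fine torus
  set G : TSite d (fineP L m) → ℝ := fun x => if x = b.1 then ‖X‖ else 0 with hG
  have hG0 : ∀ x, 0 ≤ G x := fun x => by simp only [hG]; split_ifs <;> positivity
  have hGsum : ∑ x, G x = ‖X‖ := by simp [hG]
  -- for each shift `ie_{b.2}` the chart hits `b₋` at most once
  have key : ∀ i : ℕ, ∑ y : TSite d m, ∑ r : Fin d → Fin L, G (perSite (fineP L m) (cornerSite L y + boxVec L r + (i : ℤ) • e b.2)) ≤ ‖X‖ := by
    intro i
    rw [← Fintype.sum_prod_type']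
    exact (sum_chart_le L m ((i : ℤ) • e b.2) hG0).trans hGsum.le
  -- only the direction `b.2` contributes
  have hdir : ∀ y : TSite d m, ∑ κ : Fin d, ∑ r : Fin d → Fin L, ∑ i ∈ Finset.range L,
      ‖(Pi.single b X : Bond d (fineP L m) → 𝔸) (perSite (fineP L m) (cornerSite L y + boxVec L r + (i : ℤ) • e κ), κ)‖ =
      ∑ r : Fin d → Fin L, ∑ i ∈ Finset.range L, G (perSite (fineP L m) (cornerSite L y + boxVec L r + (i : ℤ) • e b.2)) := by
    intro y
    rw [Finset.sum_eq_single b.2 (fun κ _ hκ => ?_) (fun h => (h (Finset.mem_univ _)).elim)]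
    · refine Finset.sum_congr rfl fun r _ => Finset.sum_congr rfl fun i _ => ?_
      rw [norm_single_apply_eq L m b X, if_pos rfl]
    · refine Finset.sum_eq_zero fun r _ => Finset.sum_eq_zero fun i _ => ?_
      rw [norm_single_apply_eq L m b X, if_neg hκ]
  calc ∑ c : Bond d m, ∑ r : Fin d → Fin L, ∑ i ∈ Finset.range L,
        ‖(Pi.single b X : Bond d (fineP L m) → 𝔸) (perSite (fineP L m) (cornerSite L c.1 + boxVec L r + (i : ℤ) • e c.2), c.2)‖
      = ∑ y : TSite d m, ∑ r : Fin d → Fin L, ∑ i ∈ Finset.range L,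
          G (perSite (fineP L m) (cornerSite L y + boxVec L r + (i : ℤ) • e b.2)) := by
        rw [Fintype.sum_prod_type]
        exact Finset.sum_congr rfl fun y _ => hdir y
    _ = ∑ y : TSite d m, ∑ i ∈ Finset.range L, ∑ r : Fin d → Fin L, G (perSite (fineP L m) (cornerSite L y + boxVec L r + (i : ℤ) • e b.2)) :=
        Finset.sum_congr rfl fun y _ => Finset.sum_comm
    _ = ∑ i ∈ Finset.range L, ∑ y : TSite d m, ∑ r : Fin d → Fin L, G (perSite (fineP L m) (cornerSite L y + boxVec L r + (i : ℤ) • e b.2)) :=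
        Finset.sum_comm
    _ ≤ ∑ _i ∈ Finset.range L, ‖X‖ := Finset.sum_le_sum fun i _ => key i
    _ = L * ‖X‖ := by rw [Finset.sum_const, Finset.card_range, nsmul_eq_mul]

omit [∀ i, NeZero (m i)] [NormedAlgebra ℂ 𝔸] [CompleteSpace 𝔸] [NormOneClass 𝔸] in
/-- **EACH MAIN SUM SEES `b` AT MOST `L` TIMES**: `Σ_r Σ_{i<L} ‖δ_b^X((L·c₋ + r + ie_{c.2}) mod Lm, c.2)‖ ≤ L·‖X‖` (one coarse bond's share of the total).
[folklore] [cite: Balaban1985Averaging, (125) p.36; Balaban1985BackgroundPropagators, (3.15) p.393] -/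
theorem main_single_le [DecidableEq (Bond d (fineP L m))] (b : Bond d (fineP L m)) (X : 𝔸) (c : Bond d m) :
    ∑ r : Fin d → Fin L, ∑ i ∈ Finset.range L,
        ‖(Pi.single b X : Bond d (fineP L m) → 𝔸) (perSite (fineP L m) (cornerSite L c.1 + boxVec L r + (i : ℤ) • e c.2), c.2)‖ ≤ L * ‖X‖ := by
  refine le_trans ?_ (sum_main_single_le L m b X)
  set F : Bond d m → ℝ := fun c => ∑ r : Fin d → Fin L, ∑ i ∈ Finset.range L,
      ‖(Pi.single b X : Bond d (fineP L m) → 𝔸) (perSite (fineP L m) (cornerSite L c.1 + boxVec L r + (i : ℤ) • e c.2), c.2)‖ with hF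
  exact (Finset.single_le_sum (f := F) (fun c' _ => by positivity) (Finset.mem_univ c) : F c ≤ ∑ c' : Bond d m, F c')

include hL in
omit [NeZero L] [∀ i, NeZero (m i)] in
/-- **THE SHARP SINGLE-BOND LETTER, `𝔸`-valued**: `‖(Q(U)δ_b^X)(c)‖ ≤ (L^{−d} + 50(d+1)α)·‖X‖` at EVERY coarse bond `c` — print's `|(Q₀A)_c| ≤ |A|` read for ONE
summand of the normalised average (weight `L^{−(d+1)}·#{paths through b} ≤ L^{−d}`), plus the (124) defect brackets at the crude rate. [folklore]
[cite: Balaban1985Averaging, (124)–(126) p.36; Balaban1985BackgroundPropagators, (3.15) p.393] -/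
theorem norm_QtorusLin_single_le [NeZero L] [DecidableEq (Bond d (fineP L m))] (b : Bond d (fineP L m)) (X : 𝔸) (c : Bond d m) :
    ‖QtorusLin L m hL U hα1 hU1 hreg (Pi.single b X) c‖ ≤ (((L : ℝ) ^ d)⁻¹ + 50 * (d + 1) * α) * ‖X‖ := by
  have hLpos : (0 : ℝ) < L := by exact_mod_cast hL
  have hsup : ∀ b', ‖(Pi.single b X : Bond d (fineP L m) → 𝔸) b'‖ ≤ ‖X‖ := fun b' => by
    rw [Pi.single_apply]; split_ifs <;> simp
  have h := norm_QtorusLin_apply_le_sum_add L m hL U hα1 hU1 hreg (Pi.single b X) (norm_nonneg X) hsup c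
  have hm := main_single_le L m b X c
  have hpow : ((L : ℝ) ^ (d + 1))⁻¹ * (L * ‖X‖) = ((L : ℝ) ^ d)⁻¹ * ‖X‖ := by
    rw [pow_succ]; field_simp
  calc ‖QtorusLin L m hL U hα1 hU1 hreg (Pi.single b X) c‖
      ≤ ((L : ℝ) ^ (d + 1))⁻¹ * (L * ‖X‖) + 50 * (d + 1) * α * ‖X‖ :=
        h.trans (add_le_add (mul_le_mul_of_nonneg_left hm (by positivity)) le_rfl)
    _ = (((L : ℝ) ^ d)⁻¹ + 50 * (d + 1) * α) * ‖X‖ := by rw [hpow]; ring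

include hL in
omit [NeZero L] [∀ i, NeZero (m i)] in
/-- **THE COLUMN FORM**: `Σ_c ‖(Q(U)δ_b^X)(c)‖ ≤ (L^{−d} + 2d·50(d+1)α)·‖X‖` — off the (at most `2d`, `card_near_le`) coarse bonds `c` with
`B(b) ∈ {c₋, c₋ + e_{c.2}}` the value VANISHES (`QtorusLin_apply_eq_zero_of_support`); the main sums of all `c` together see `b` at most `L` times
(`sum_main_single_le`); each zone bond pays the defect brackets once. [folklore]
[cite: Balaban1985Averaging, p.24, (124)–(126) p.36; Balaban1985BackgroundPropagators, (3.15) p.393] -/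
theorem sum_norm_QtorusLin_single_le [NeZero L] [DecidableEq (Bond d (fineP L m))] (b : Bond d (fineP L m)) (X : 𝔸) :
    ∑ c : Bond d m, ‖QtorusLin L m hL U hα1 hU1 hreg (Pi.single b X) c‖ ≤ (((L : ℝ) ^ d)⁻¹ + 2 * d * (50 * (d + 1) * α)) * ‖X‖ := by
  classical
  have hLpos : (0 : ℝ) < L := by exact_mod_cast hL
  set v : TSite d m := blockCoord L m b.1 with hv
  have hα0 : 0 ≤ α := alpha_nonneg L m hL U hreg (v, b.2)
  set F : Bond d m → ℝ := fun c => ∑ r : Fin d → Fin L, ∑ i ∈ Finset.range L,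
      ‖(Pi.single b X : Bond d (fineP L m) → 𝔸) (perSite (fineP L m) (cornerSite L c.1 + boxVec L r + (i : ℤ) • e c.2), c.2)‖ with hF
  have hF0 : ∀ c, 0 ≤ F c := fun c => Finset.sum_nonneg fun r _ => Finset.sum_nonneg fun i _ => norm_nonneg _
  set R : ℝ := 50 * (d + 1) * α * ‖X‖ with hR
  have hR0 : 0 ≤ R := by positivity
  have hsup : ∀ b', ‖(Pi.single b X : Bond d (fineP L m) → 𝔸) b'‖ ≤ ‖X‖ := fun b' => by
    rw [Pi.single_apply]; split_ifs <;> simp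
  -- the spike vanishes off the block `v`
  have hAv : ∀ b' : Bond d (fineP L m), blockCoord L m b'.1 ≠ v → (Pi.single b X : Bond d (fineP L m) → 𝔸) b' = 0 := fun b' hb' => by
    by_cases h : b' = b
    · exact (hb' (by rw [h])).elim
    · exact Pi.single_eq_of_ne h _
  -- per coarse bond: main sum + the defect brackets on the zone, zero off the zone
  have hc : ∀ c : Bond d m, ‖QtorusLin L m hL U hα1 hU1 hreg (Pi.single b X) c‖ ≤
      ((L : ℝ) ^ (d + 1))⁻¹ * F c + (if v = c.1 ∨ v = shift c.2 c.1 then R else 0) := by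
    intro c
    by_cases hz : v = c.1 ∨ v = shift c.2 c.1
    · rw [if_pos hz]
      exact norm_QtorusLin_apply_le_sum_add L m hL U hα1 hU1 hreg (Pi.single b X) (norm_nonneg X) hsup c
    · rw [if_neg hz, add_zero]
      simp only [not_or] at hz
      rw [QtorusLin_apply_eq_zero_of_support L m hL U hα1 hU1 hreg v _ hAv c (Ne.symm hz.1) (Ne.symm hz.2), norm_zero]
      exact mul_nonneg (by positivity) (hF0 c)
  have hzone : ∑ c : Bond d m, (if v = c.1 ∨ v = shift c.2 c.1 then R else 0) ≤ 2 * d * R := by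
    rw [← Finset.sum_filter, Finset.sum_const, nsmul_eq_mul]
    refine mul_le_mul_of_nonneg_right ?_ hR0
    exact_mod_cast card_near_le m v
  have hmain : ((L : ℝ) ^ (d + 1))⁻¹ * ∑ c : Bond d m, F c ≤ ((L : ℝ) ^ d)⁻¹ * ‖X‖ := by
    have h := sum_main_single_le L m b X
    calc ((L : ℝ) ^ (d + 1))⁻¹ * ∑ c : Bond d m, F c ≤ ((L : ℝ) ^ (d + 1))⁻¹ * (L * ‖X‖) := mul_le_mul_of_nonneg_left h (by positivity)
      _ = ((L : ℝ) ^ d)⁻¹ * ‖X‖ := by rw [pow_succ]; field_simp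
  calc ∑ c : Bond d m, ‖QtorusLin L m hL U hα1 hU1 hreg (Pi.single b X) c‖
      ≤ ∑ c : Bond d m, (((L : ℝ) ^ (d + 1))⁻¹ * F c + (if v = c.1 ∨ v = shift c.2 c.1 then R else 0)) := Finset.sum_le_sum fun c _ => hc c
    _ = ((L : ℝ) ^ (d + 1))⁻¹ * ∑ c : Bond d m, F c + ∑ c : Bond d m, (if v = c.1 ∨ v = shift c.2 c.1 then R else 0) := by
        rw [Finset.sum_add_distrib, Finset.mul_sum]
    _ ≤ ((L : ℝ) ^ d)⁻¹ * ‖X‖ + 2 * d * R := add_le_add hmain hzone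
    _ = (((L : ℝ) ^ d)⁻¹ + 2 * d * (50 * (d + 1) * α)) * ‖X‖ := by rw [hR]; ring

/-! ## §4 The `ℓ¹ → ℓ¹` letter of `Q(U)` -/

include hL in
omit [NeZero L] [∀ i, NeZero (m i)] in
/-- **THE `ℓ¹ → ℓ¹` LETTER OF THE ONE-STEP AVERAGING**: `Σ_c ‖(Q(U)A)(c)‖ ≤ (L^{−d} + 100d(d+1)α)·Σ_b ‖A(b)‖` — linearity over the spikes `A = Σ_b δ_b^{A(b)}`
and the column letter `sum_norm_QtorusLin_single_le`; the `L^{−d}` is print's «|(Q₀A)_c| ≤ |A|» in the `ℓ¹` currency (an average does not increase mass), the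
`100d(d+1)α` the defect brackets.  The one-step factor of the tower's composite letter. [folklore]
[cite: Balaban1985Averaging, (124)–(126) p.36, p.24; Balaban1985BackgroundPropagators, (3.15)–(3.16) p.393] -/
theorem sum_norm_QtorusLin_le [NeZero L] (A : Bond d (fineP L m) → 𝔸) :
    ∑ c : Bond d m, ‖QtorusLin L m hL U hα1 hU1 hreg A c‖ ≤ (((L : ℝ) ^ d)⁻¹ + 100 * d * (d + 1) * α) * ∑ b, ‖A b‖ := by
  classical
  have hA : QtorusLin L m hL U hα1 hU1 hreg A = ∑ b, QtorusLin L m hL U hα1 hU1 hreg (Pi.single b (A b)) := by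
    rw [← map_sum, Finset.univ_sum_single]
  calc ∑ c : Bond d m, ‖QtorusLin L m hL U hα1 hU1 hreg A c‖
      = ∑ c : Bond d m, ‖∑ b, QtorusLin L m hL U hα1 hU1 hreg (Pi.single b (A b)) c‖ := by
        refine Finset.sum_congr rfl fun c _ => ?_
        rw [hA, Finset.sum_apply]
    _ ≤ ∑ c : Bond d m, ∑ b, ‖QtorusLin L m hL U hα1 hU1 hreg (Pi.single b (A b)) c‖ := Finset.sum_le_sum fun c _ => norm_sum_le _ _
    _ = ∑ b, ∑ c : Bond d m, ‖QtorusLin L m hL U hα1 hU1 hreg (Pi.single b (A b)) c‖ := Finset.sum_comm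
    _ ≤ ∑ b, (((L : ℝ) ^ d)⁻¹ + 2 * d * (50 * (d + 1) * α)) * ‖A b‖ :=
        Finset.sum_le_sum fun b _ => sum_norm_QtorusLin_single_le L m hL U hα1 hU1 hreg b (A b)
    _ = (((L : ℝ) ^ d)⁻¹ + 100 * d * (d + 1) * α) * ∑ b, ‖A b‖ := by rw [← Finset.mul_sum]; ring

end Torus

/-! ## §5 On the chain's carriers: the sharp `k_Q` and the penalty's local letter with print's size -/

section Carrier

variable {d : ℕ} (L : ℕ) [NeZero L] (m : Fin d → ℕ) [∀ i, NeZero (m i)] [∀ i, NeZero (fineP L m i)]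
  {𝔸 : Type*} [NormedRing 𝔸] [NormedAlgebra ℂ 𝔸] [CompleteSpace 𝔸] [NormOneClass 𝔸] (hL : 1 ≤ L)
  (U : Bond d (fineP L m) → 𝔸ˣ) {α : ℝ} (hα1 : α ≤ 1 / 64)
  (hU1 : ∀ (x : B7Prop1Explicit.Site d) (κ : Fin d), perCfg (fineP L m) U x κ ∈ U1 𝔸)
  (hreg : ∀ (y : TSite d m) (κ : Fin d) (r : Fin d → Fin L),
    ‖((Wcx L (perCfg (fineP L m) U) (cornerSite L y) κ (boxVec L r) : 𝔸ˣ) : 𝔸) - 1‖ ≤ α)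
  {W : Type*} [NormedAddCommGroup W] [InnerProductSpace ℂ W] (φ : W ≃ₗ[ℂ] 𝔸) {c₀ c₁ : ℝ} [Fact (0 < c₀)] [Fact (0 < c₁)]
  {Mφ Mφ' : ℝ} (hMφ : 0 ≤ Mφ) (hφ : ∀ w, ‖φ w‖ ≤ Mφ * ‖w‖) (hMφ' : 0 ≤ Mφ') (hφ' : ∀ X, ‖φ.symm X‖ ≤ Mφ' * ‖X‖)

include hφ hMφ' hφ' in
omit [∀ i, NeZero (m i)] [Fact (0 < c₀)] [Fact (0 < c₁)] in
/-- **THE SHARP `k_Q`** (t4-ne9-idea-1 L-g150-7): `‖(Q(U)δ_b^u)(c)‖ ≤ M_φ′·(L^{−d} + 50(d+1)α)·M_φ·‖u‖` at EVERY coarse bond — the chain's `QtorusW` reads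
`QtorusLin` on `φ∘δ_b^u = δ_b^{φu}` along `φ⁻¹`. [folklore] [cite: Balaban1985BackgroundPropagators, (3.15) p.393; Balaban1985Averaging, (125)–(126) p.36] -/
theorem norm_QtorusW_single_le [DecidableEq (Bond d (fineP L m))] (b : Bond d (fineP L m)) (u : W) (c : Bond d m) :
    ‖WL2.equiv ℂ (fun _ : Bond d m => c₁) W (QtorusW L m hL φ U hα1 hU1 hreg (c₀ := c₀) (c₁ := c₁)
        ((WL2.equiv ℂ (fun _ : Bond d (fineP L m) => c₀) W).symm (Pi.single b u))) c‖ ≤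
      Mφ' * (((L : ℝ) ^ d)⁻¹ + 50 * (d + 1) * α) * Mφ * ‖u‖ := by
  have hα0 : 0 ≤ α := alpha_nonneg L m hL U hreg c
  have hfun : (fun b' => φ (WL2.equiv ℂ (fun _ : Bond d (fineP L m) => c₀) W
      ((WL2.equiv ℂ (fun _ : Bond d (fineP L m) => c₀) W).symm (Pi.single b u)) b')) = Pi.single b (φ u) := by
    funext b'
    rw [Equiv.apply_symm_apply]
    by_cases h : b' = b
    · rw [h, Pi.single_eq_same, Pi.single_eq_same]
    · rw [Pi.single_eq_of_ne h, Pi.single_eq_of_ne h, map_zero]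
  rw [QtorusW_apply, hfun]
  refine (hφ' _).trans ?_
  rw [mul_assoc, mul_assoc]
  refine mul_le_mul_of_nonneg_left ?_ hMφ'
  calc ‖QtorusLin L m hL U hα1 hU1 hreg (Pi.single b (φ u)) c‖ ≤ (((L : ℝ) ^ d)⁻¹ + 50 * (d + 1) * α) * ‖φ u‖ :=
        norm_QtorusLin_single_le L m hL U hα1 hU1 hreg b (φ u) c
    _ ≤ (((L : ℝ) ^ d)⁻¹ + 50 * (d + 1) * α) * (Mφ * ‖u‖) := mul_le_mul_of_nonneg_left (hφ u) (by positivity)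

variable [FiniteDimensional ℂ W]

include hMφ hφ hMφ' hφ' in
omit [∀ i, NeZero (m i)] in
/-- **THE ADJOINT `Q(U)†` POINTWISE FROM LOCAL DATA AT THE SHARP `k_Q`**: `‖h(c)‖ ≤ M` at the coarse bonds `c` with `B(b) ∈ {c₋, c₋ + e_{c.2}}` (`0 ≤ M`) ⟹
`‖(Q(U)†h)(b)‖ ≤ (c₁∕c₀)·M_φ′(L^{−d} + 50(d+1)α)M_φ·2d·M` (ne9-leaf-05's `norm_adjoint_QtorusW_apply_le_local_of_letter` at `k_Q := ` §5's letter). [folklore]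
[cite: Balaban1985BackgroundPropagators, (3.16) p.393, (3.11) p.392; Balaban1985Averaging, p.24, (125)–(126) p.36] -/
theorem norm_adjoint_QtorusW_apply_le_local_sharp [DecidableEq (Bond d (fineP L m))] (h : BondL2K ℂ d m c₁ W) (b : Bond d (fineP L m)) {M : ℝ}
    (hM : 0 ≤ M)
    (hh : ∀ c : Bond d m, (blockCoord L m b.1 = c.1 ∨ blockCoord L m b.1 = shift c.2 c.1) → ‖WL2.equiv ℂ (fun _ : Bond d m => c₁) W h c‖ ≤ M) :
    ‖WL2.equiv ℂ (fun _ : Bond d (fineP L m) => c₀) W (LinearMap.adjoint (QtorusW L m hL φ U hα1 hU1 hreg (c₀ := c₀) (c₁ := c₁)) h) b‖ ≤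
      c₁ / c₀ * (Mφ' * (((L : ℝ) ^ d)⁻¹ + 50 * (d + 1) * α) * Mφ) * ((2 * d : ℕ) : ℝ) * M := by
  have hα0 : 0 ≤ α := alpha_nonneg L m hL U hreg (blockCoord L m b.1, b.2)
  exact norm_adjoint_QtorusW_apply_le_local_of_letter L m hL U hα1 hU1 hreg φ h b (by positivity)
    (fun u c _ => norm_QtorusW_single_le L m hL U hα1 hU1 hreg φ hφ hMφ' hφ' b u c) hM hh

include hMφ hφ hMφ' hφ' in
/-- **THE LOCAL POINTWISE LETTER OF THE PENALTY AT THE SHARP `k_Q`**: `‖v(b′)‖ ≤ M` for `d_m(B(b), B(b′)) ≤ 2` (`1 ≤ m_i`, `0 ≤ M`) ⟹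
`‖((Q†(a•Q))v)(b)‖ ≤ |a|·(c₁∕c₀)·M_φ′(L^{−d} + 50(d+1)α)M_φ·2d·((M_φ′C_QM_φ)·M)`, `C_Q = 1 + 50(d+1)α`. [folklore]
[cite: Balaban1985BackgroundPropagators, (3.16) p.393, (3.26) p.395, (3.11) p.392; Balaban1985Averaging, p.24, (125)–(126) p.36] -/
theorem norm_penalty_QtorusW_apply_le_local_sharp [DecidableEq (Bond d (fineP L m))] (hm : ∀ i, 1 ≤ m i) (a : ℝ)
    (v : BondL2K ℂ d (fineP L m) c₀ W) (b : Bond d (fineP L m)) {M : ℝ} (hM : 0 ≤ M)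
    (hv : ∀ b' : Bond d (fineP L m), tdist m (blockCoord L m b.1) (blockCoord L m b'.1) ≤ 2 → ‖WL2.equiv ℂ (fun _ : Bond d (fineP L m) => c₀) W v b'‖ ≤ M) :
    ‖WL2.equiv ℂ (fun _ : Bond d (fineP L m) => c₀) W
        ((LinearMap.adjoint (QtorusW L m hL φ U hα1 hU1 hreg (c₀ := c₀) (c₁ := c₁)) ∘ₗ
          ((a : ℂ) • QtorusW L m hL φ U hα1 hU1 hreg (c₀ := c₀) (c₁ := c₁))) v) b‖ ≤
      |a| * (c₁ / c₀ * (Mφ' * (((L : ℝ) ^ d)⁻¹ + 50 * (d + 1) * α) * Mφ) * ((2 * d : ℕ) : ℝ) * ((Mφ' * (1 + 50 * (d + 1) * α) * Mφ) * M)) := by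
  have hα0 : 0 ≤ α := alpha_nonneg L m hL U hreg (blockCoord L m b.1, b.2)
  exact norm_penalty_QtorusW_apply_le_local_of_letter L m hL U hα1 hU1 hreg φ hMφ hφ hMφ' hφ' hm a v b (by positivity)
    (fun u c _ => norm_QtorusW_single_le L m hL U hα1 hU1 hreg φ hφ hMφ' hφ' b u c) hM hv

include hMφ hφ hMφ' hφ' in
/-- **ON THE ONE-STEP DIAGONAL `c₁ = L^d·c₀` THE PENALTY HAS PRINT's SIZE `O(|a|)`**: `‖((Q†(a•Q))v)(b)‖ ≤ |a|·(1 + 50(d+1)α·L^d)·M_φ′M_φ·2d·(M_φ′C_QM_φ)·M` — the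
carriers' `c₁∕c₀ = L^d` is compensated by the `L^{−d}` of the sharp `k_Q`; no power of `L` survives in front of `|a|` (the crude letter read `|a|·L^d·…`).
[folklore] [cite: Balaban1985BackgroundPropagators, (3.16) p.393, (3.26) p.395; Balaban1985Averaging, (125)–(126) p.36] -/
theorem norm_penalty_QtorusW_apply_le_local_sharp_diagonal [DecidableEq (Bond d (fineP L m))] (hm : ∀ i, 1 ≤ m i) (hc : c₁ = (L : ℝ) ^ d * c₀) (a : ℝ)
    (v : BondL2K ℂ d (fineP L m) c₀ W) (b : Bond d (fineP L m)) {M : ℝ} (hM : 0 ≤ M)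
    (hv : ∀ b' : Bond d (fineP L m), tdist m (blockCoord L m b.1) (blockCoord L m b'.1) ≤ 2 → ‖WL2.equiv ℂ (fun _ : Bond d (fineP L m) => c₀) W v b'‖ ≤ M) :
    ‖WL2.equiv ℂ (fun _ : Bond d (fineP L m) => c₀) W
        ((LinearMap.adjoint (QtorusW L m hL φ U hα1 hU1 hreg (c₀ := c₀) (c₁ := c₁)) ∘ₗ
          ((a : ℂ) • QtorusW L m hL φ U hα1 hU1 hreg (c₀ := c₀) (c₁ := c₁))) v) b‖ ≤
      |a| * ((1 + 50 * (d + 1) * α * (L : ℝ) ^ d) * (Mφ' * Mφ) * ((2 * d : ℕ) : ℝ) * ((Mφ' * (1 + 50 * (d + 1) * α) * Mφ) * M)) := by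
  have hc₀ : (0 : ℝ) < c₀ := (Fact.out : (0 : ℝ) < c₀)
  have hLd : (0 : ℝ) < (L : ℝ) ^ d := by
    have : (0 : ℝ) < L := by exact_mod_cast hL
    positivity
  have h := norm_penalty_QtorusW_apply_le_local_sharp (c₁ := c₁) L m hL U hα1 hU1 hreg φ hMφ hφ hMφ' hφ' hm a v b hM hv
  have he : c₁ / c₀ * (Mφ' * (((L : ℝ) ^ d)⁻¹ + 50 * (d + 1) * α) * Mφ) = (1 + 50 * (d + 1) * α * (L : ℝ) ^ d) * (Mφ' * Mφ) := by
    rw [hc]; field_simp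
  rw [he] at h
  exact h

end Carrier

end Literature.MathematicalPhysics.QuantumFieldTheory.Balaban1983to89.B9Eq315QSingleBondLetter

end
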